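import Summits.BirchSwinnertonDyer.Rank1Residual.ManinAdditive.ThetaTwistOmega
import HarnessLib

/-!
# The `f`-coordinate of an `Ω₃`-witness is bounded BELOW by `−v₃(deg φ)` under the GIVEN row; hence rows
# E-desc-157₂ / 157₃ / 157₄ together with the degree law E-desc-124 FORCE `3 ∤ m` (resp. `2·v₃ m ≤ v₃ n`, `1 + 2·v₃ m ≤ v₃ n`)
# (cell bsd-f2-manin, REF1 statement audit §R198 of ty p744572 / desc MEMO-desc §47.13–§47.15; supports C3
# `ManinPrimeToThreeAtNine`, stmt-BirchSwinnertonDyer-22968; Negative lane: TIGHTNESS lemmas, nothing under `@[conjecture]`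
# is used as a fact, no Theses statement is concluded)

WHAT IS PROVED (kernel, standard axioms).
* `padicValRat_coord_ge_of_isOmegaNeronAtThree`: for a `NeronFLineDatum` `Δ` with imc's GIVEN row `IsOmegaNeronAtThree Δ`
  (`Λ ≤ Ω₃(N)` and every element of `Ω₃(N)` has a prime-to-3 multiple in `Λ`), EVERY `x ∈ Ω₃(N)` with `f`-coordinate `q ≠ 0`
  (`q⟨f,f⟩ = ⟨f,x⟩`) has `−v₃(deg φ) ≤ v₃(q)`: `ξ^*(n•x)·c = deg φ·(n q)` with `ξ^*(n•x), c ∈ ℤ`, `3 ∤ n`.  (The proof is the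
  lower-bound half of desc's PROVED `manin_and_depth_of_omegaWitness`, isolated.)  So the witness rows of the desc lens can never
  produce depth BEYOND `v₃(deg φ)`; their bounds are TIGHT exactly when they decide C3.
* `sqDegreeLaw_val_eq`: the exact `3`-adic content of an identity `3 m² d = 4 n H` (shape of E-desc-124):
  `v₃ d + 1 + 2 v₃ m = v₃ H + v₃ |n|`.
* CONSEQUENCES (load-bearing analysis of the guards; `m` = the multiplier of E-desc-124, `n = −v₃ j = #Φ₃ − 4… = n` of `Iₙ*`):
  - `two_mul_padicValNat_le_of_thetaFourSqOmegaWitness`: E-desc-157₂ ∧ GIVEN ∧ (the identity of E-124 with multiplier `m`) at a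
    curve meeting the guards ⟹ `2·v₃(m) ≤ v₃(n)`;
  - `succ_two_mul_padicValNat_le_of_thetaTwistOmegaWitness`: E-desc-157₃ ∧ … ⟹ `1 + 2·v₃(m) ≤ v₃(n)`;
  - `not_three_dvd_of_thetaTwistOmegaWitnessVal`: E-desc-157₄ ∧ … ⟹ `3 ∤ m`.
  Read contrapositively: an optimal `Iₙ*` curve at prime level `9p` with a rational 3-isogeny-type multiplier `3 ∣ m` (desc:
  `m = 3` on 8 of the 206 prime-level classes `9p ≤ 9999`) and `v₃(n) ≤ 1` that MET the two guards `WeightedNotThreeDivisible`,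
  `WeightedDifferenceNotThreeDivisible` would refute E-desc-157₂ (and 157₄) given E-124 there and the GIVEN row.
CENSUS (REF1 second engine `HOME/ref1/e198/brandt3i.py`, independent of desc's: `B_{3,∞} = (−1,−3)_ℚ`, unit orbits on `ℙ¹(𝔽_p)`,
`T_ℓ` with the `θ₄²`-character, eigenline of `12·χ₋₃(ℓ)·a_ℓ(E)`, `a_ℓ` by point counting on Cremona's `allcurves`): the 8 prime-level
classes with `m = 3` (153b1 `p = 17` I₃*, 801c1 `89` I₃*, 1611f1 `179` I₆*, 2259c1 `251` I₆*, 2421b1 `269` I₆*, 3879f1 `431` I₃*,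
5013b1 `557` I₁₂*, 5337d1 `593` I₃*) ALL have `Wg ≡ ±const (mod 3)` (content of `Wg` prime to 3, content of the differences
divisible by 3): the guard `WeightedDifferenceNotThreeDivisible` FAILS at every one of them (8/8), and holds at the 19 tested classes
with `3 ∤ m`.  So the rows are CONSISTENT with E-124 ∧ GIVEN on Cremona's prime-level range, and the difference guard is load-bearing
(it is exactly what removes the `3 ∣ m` classes).  Nothing here bears on the TRUTH of E-desc-157₂/157₃/157₄ or E-124.
BSD is not proved by this; Manin's conjecture is not proved by this; C3 OPEN.
-/

set_option autoImplicit false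
set_option linter.dupNamespace false

open scoped MatrixGroups ModularForm
open CongruenceSubgroup WeierstrassCurve Literature.NumberTheory.EllipticCurves
open Literature.NumberTheory.EllipticCurves.ModularForms
open Summit.BirchSwinnertonDyer.Rank1Residual.ManinAdditive
open Summit.BirchSwinnertonDyer.Rank1Residual.ManinAdditive.ThetaFourBrandt
open Summit.BirchSwinnertonDyer.Rank1Residual.ManinAdditive.NeronOmegaThree
open Summit.BirchSwinnertonDyer.Rank1Residual.ManinAdditive.ThetaFourOmega

namespace Summit.BirchSwinnertonDyer.BirchSwinnertonDyer.Theorems.ManinPrimeToThreeAtNine.Negative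

/-! ### §1. The lower bound on the `f`-coordinate inside `Ω₃` under the GIVEN row -/

section LowerBound

variable {N : ℕ} [NeZero N] {W : WeierstrassCurve ℚ} [W.IsElliptic] {D : ModularParametrizationData W N}
  (Δ : NeronFLineDatum W D)

/-- GIVEN row `IsOmegaNeronAtThree Δ` ⟹ every `x ∈ Ω₃(N)` whose `f`-coordinate is `q ≠ 0` has `−v₃(deg φ) ≤ v₃ q`
(`ξ^*(n • x) · c = deg φ · n q` in `ℚ` with `ξ^*(n • x), c ∈ ℤ` and `3 ∤ n`). [folklore] -/
theorem padicValRat_coord_ge_of_isOmegaNeronAtThree (hΩ : IsOmegaNeronAtThree Δ)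
    {x : CuspForm (Gamma0 N) 2} (hx : x ∈ omegaLatticeAtThree N) {q : ℚ} (hq0 : q ≠ 0)
    (hq : (q : ℂ) * peterssonProduct (Gamma0 N) 2 D.f D.f = peterssonProduct (Gamma0 N) 2 D.f x) :
    -(padicValNat 3 D.modularDegree : ℤ) ≤ padicValRat 3 q := by
  haveI : Fact (Nat.Prime 3) := ⟨Nat.prime_three⟩
  obtain ⟨n, hn3, hnx⟩ := hΩ.2 x hx
  have hn0 : n ≠ 0 := by rintro rfl; exact hn3 (dvd_zero 3)
  set g : Δ.Λ := ⟨(n : ℤ) • x, hnx⟩ with hg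
  have hq' : ((n * q : ℚ) : ℂ) * peterssonProduct (Gamma0 N) 2 D.f D.f =
      peterssonProduct (Gamma0 N) 2 D.f (g : CuspForm (Gamma0 N) 2) := by
    have h1 : (g : CuspForm (Gamma0 N) 2) = ((n : ℤ) : ℂ) • x := by
      rw [hg]; exact (Int.cast_smul_eq_zsmul ℂ (n : ℤ) x).symm
    rw [h1, peterssonProduct_smul_right, ← hq]
    push_cast
    ring
  have hnq0 : (n : ℚ) * q ≠ 0 := mul_ne_zero (by exact_mod_cast hn0) hq0
  have hvn : padicValRat 3 (n : ℚ) = 0 := by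
    rw [padicValRat.of_nat, Nat.cast_eq_zero]
    exact padicValNat.eq_zero_of_not_dvd hn3
  have hdeg : (D.modularDegree : ℚ) ≠ 0 := by exact_mod_cast D.deg_pos.ne'
  have hκc := Δ.κ_mul_maninConstant
  have hc : (D.maninConstant : ℚ) ≠ 0 := by
    intro h0; rw [h0, mul_zero] at hκc; exact hdeg hκc.symm
  have hx' : (Δ.xiStar g : ℚ) * D.maninConstant = D.modularDegree * (n * q) := by
    rw [Δ.xiStar_eq_of_coord hq', ← hκc]; ring
  have hxz : (Δ.xiStar g : ℚ) ≠ 0 := by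
    intro h0; rw [h0, zero_mul] at hx'; exact (mul_ne_zero hdeg hnq0) hx'.symm
  have hv := congrArg (padicValRat 3) hx'
  rw [padicValRat.mul hxz hc, padicValRat.mul hdeg hnq0, padicValRat.of_int, padicValRat.of_int,
    padicValRat.of_nat, padicValRat.mul (by exact_mod_cast hn0) hq0, hvn, zero_add] at hv
  have h0 : (0 : ℤ) ≤ padicValInt 3 (Δ.xiStar g) := by exact_mod_cast Nat.zero_le _
  have h1 : (0 : ℤ) ≤ padicValInt 3 D.maninConstant := by exact_mod_cast Nat.zero_le _
  linarith

/-- Hence an `Ω₃`-witness bound of the shape `v₃ q + A ≤ B` (rows E-desc-157, 157₂, 157₃, 157₄) forces `A ≤ B + v₃(deg φ)`. [folklore] -/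
theorem witnessBound_le_of_isOmegaNeronAtThree (hΩ : IsOmegaNeronAtThree Δ)
    {x : CuspForm (Gamma0 N) 2} (hx : x ∈ omegaLatticeAtThree N) {q : ℚ} (hq0 : q ≠ 0)
    (hq : (q : ℂ) * peterssonProduct (Gamma0 N) 2 D.f D.f = peterssonProduct (Gamma0 N) 2 D.f x)
    {A B : ℤ} (hbound : padicValRat 3 q + A ≤ B) :
    A ≤ B + padicValNat 3 D.modularDegree := by
  have := padicValRat_coord_ge_of_isOmegaNeronAtThree Δ hΩ hx hq0 hq
  linarith

end LowerBound

/-! ### §2. The exact `3`-adic content of the degree identity `3 m² d = 4 n H` -/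

/-- `3 m² d = 4 n H` with `d, m ≥ 1` ⟹ `v₃ d + 1 + 2 v₃ m = v₃ H + v₃ |n|` (and `n, H ≠ 0`). [folklore] -/
theorem sqDegreeLaw_val_eq {d m : ℕ} (hd : 0 < d) (hm : 1 ≤ m) {n H : ℤ}
    (h : 3 * (m : ℤ) ^ 2 * (d : ℤ) = 4 * n * H) :
    padicValNat 3 d + 1 + 2 * padicValNat 3 m = padicValInt 3 H + padicValNat 3 n.natAbs := by
  haveI : Fact (Nat.Prime 3) := ⟨Nat.prime_three⟩
  have hm0 : m ≠ 0 := by omega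
  have hL : 3 * (m : ℤ) ^ 2 * (d : ℤ) ≠ 0 := by
    have hm0' : (m : ℤ) ≠ 0 := by exact_mod_cast hm0
    have hd0 : (d : ℤ) ≠ 0 := by exact_mod_cast hd.ne'
    exact mul_ne_zero (mul_ne_zero (by norm_num) (pow_ne_zero 2 hm0')) hd0
  have hn0 : n ≠ 0 := by rintro rfl; exact hL (by rw [h]; ring)
  have hH : H ≠ 0 := by rintro rfl; exact hL (by rw [h]; ring)
  have hnat : 3 * m ^ 2 * d = 4 * n.natAbs * H.natAbs := by
    have := congrArg Int.natAbs h
    simpa [Int.natAbs_mul, Int.natAbs_pow] using this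
  have hHn : H.natAbs ≠ 0 := Int.natAbs_ne_zero.mpr hH
  have hnn : n.natAbs ≠ 0 := Int.natAbs_ne_zero.mpr hn0
  have h34 : padicValNat 3 4 = 0 := padicValNat.eq_zero_of_not_dvd (by norm_num)
  have h33 : padicValNat 3 3 = 1 := padicValNat_self
  have hm2 : padicValNat 3 (m ^ 2) = 2 * padicValNat 3 m := by rw [pow_two, padicValNat.mul hm0 hm0, two_mul]
  have hv := congrArg (padicValNat 3) hnat
  rw [padicValNat.mul (by positivity) hd.ne', padicValNat.mul (by norm_num) (by positivity), h33, hm2,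
    padicValNat.mul (by positivity) hHn, padicValNat.mul (by norm_num) hnn, h34] at hv
  simp only [padicValInt]
  omega

/-! ### §3. Consequences: what the witness rows force on the multiplier `m` of E-desc-124 -/

section Consequences

variable {p : ℕ} {W : WeierstrassCurve ℚ} [W.IsElliptic] [NeZero (W.conductorNorm ℤ)]
  {D : ModularParametrizationData W (W.conductorNorm ℤ)}

/-- E-desc-157₂ ∧ GIVEN ∧ (the E-124 identity with multiplier `m`) at a curve meeting the guards ⟹ `2·v₃(m) ≤ v₃(n)`
(`n = −v₃ j`).  In particular `3 ∣ m`, `v₃(n) ≤ 1` is impossible there. [folklore] -/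
theorem two_mul_padicValNat_le_of_thetaFourSqOmegaWitness (hΘ : ThetaFourSqOmegaWitnessAtNinePrime)
    (hp : p.Prime) (h5 : 5 ≤ p) (Δ : NeronFLineDatum W D) (hN : W.conductorNorm ℤ = 9 * p) (hΩ : IsOmegaNeronAtThree Δ)
    {g : Fin (p + 1) → ZI} (hU : IsUnitInvariant3 p g) (hH : IsThetaFourSqHeckeEigen p g (fun n => W.LFunction n))
    (hW : WeightedNotThreeDivisible p g) (hWd : WeightedDifferenceNotThreeDivisible p g)
    {m : ℕ} (hm : 1 ≤ m) (hlaw : 3 * (m : ℤ) ^ 2 * (D.modularDegree : ℤ) = 4 * (-padicValRat 3 W.j) * thetaFourHeightSix p g) :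
    2 * padicValNat 3 m ≤ padicValNat 3 (padicValRat 3 W.j).natAbs := by
  obtain ⟨x, hx, q, hq0, hq, hval⟩ := hΘ p hp h5 W D hN g hU hH hW hWd
  have hb := witnessBound_le_of_isOmegaNeronAtThree Δ hΩ hx hq0 hq hval
  have hv := sqDegreeLaw_val_eq (d := D.modularDegree) D.deg_pos hm hlaw
  rw [Int.natAbs_neg] at hv
  omega

/-- E-desc-157₃ ∧ GIVEN ∧ (the E-124 identity with multiplier `m`) at a curve meeting the guards (and `3 ∣ v₃ j`) ⟹
`1 + 2·v₃(m) ≤ v₃(n)`. [folklore] -/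
theorem succ_two_mul_padicValNat_le_of_thetaTwistOmegaWitness (hΘ : ThetaTwistOmegaWitnessAtNinePrime)
    (hp : p.Prime) (h5 : 5 ≤ p) (Δ : NeronFLineDatum W D) (hN : W.conductorNorm ℤ = 9 * p) (hΩ : IsOmegaNeronAtThree Δ)
    (hj : padicValRat 3 W.j < 0) (hj3 : (3 : ℤ) ∣ padicValRat 3 W.j)
    {g : Fin (p + 1) → ZI} (hU : IsUnitInvariant3 p g) (hH : IsThetaFourSqHeckeEigen p g (fun n => W.LFunction n))
    (hW : WeightedNotThreeDivisible p g) (hWd : WeightedDifferenceNotThreeDivisible p g)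
    {m : ℕ} (hm : 1 ≤ m) (hlaw : 3 * (m : ℤ) ^ 2 * (D.modularDegree : ℤ) = 4 * (-padicValRat 3 W.j) * thetaFourHeightSix p g) :
    1 + 2 * padicValNat 3 m ≤ padicValNat 3 (padicValRat 3 W.j).natAbs := by
  obtain ⟨x, hx, q, hq0, hq, hval⟩ := hΘ p hp h5 W D hN hj hj3 g hU hH hW hWd
  have hb := witnessBound_le_of_isOmegaNeronAtThree Δ hΩ hx hq0 hq hval
  have hv := sqDegreeLaw_val_eq (d := D.modularDegree) D.deg_pos hm hlaw
  rw [Int.natAbs_neg] at hv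
  omega

/-- E-desc-157₄ ∧ GIVEN ∧ (the E-124 identity with multiplier `m`) at a curve meeting the guards ⟹ `3 ∤ m`: the sharpened
row leaves NO room for a `3`-divisible multiplier (desc: `m = 3` occurs, always with a rational `3`-isogeny; REF1 census:
the difference guard fails at all 8 such prime-level classes `≤ 9999`). [folklore] -/
theorem not_three_dvd_of_thetaTwistOmegaWitnessVal (hΘ : ThetaTwistOmegaWitnessValAtNinePrime)
    (hp : p.Prime) (h5 : 5 ≤ p) (Δ : NeronFLineDatum W D) (hN : W.conductorNorm ℤ = 9 * p) (hΩ : IsOmegaNeronAtThree Δ)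
    (hj : padicValRat 3 W.j < 0)
    {g : Fin (p + 1) → ZI} (hU : IsUnitInvariant3 p g) (hH : IsThetaFourSqHeckeEigen p g (fun n => W.LFunction n))
    (hW : WeightedNotThreeDivisible p g) (hWd : WeightedDifferenceNotThreeDivisible p g)
    {m : ℕ} (hm : 1 ≤ m) (hlaw : 3 * (m : ℤ) ^ 2 * (D.modularDegree : ℤ) = 4 * (-padicValRat 3 W.j) * thetaFourHeightSix p g) :
    ¬ 3 ∣ m := by
  haveI : Fact (Nat.Prime 3) := ⟨Nat.prime_three⟩
  obtain ⟨x, hx, q, hq0, hq, hval⟩ := hΘ p hp h5 W D hN hj g hU hH hW hWd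
  have hb := padicValRat_coord_ge_of_isOmegaNeronAtThree Δ hΩ hx hq0 hq
  have hv := sqDegreeLaw_val_eq (d := D.modularDegree) D.deg_pos hm hlaw
  rw [Int.natAbs_neg] at hv
  have hm0 : m ≠ 0 := by omega
  have hvm : padicValNat 3 m = 0 := by omega
  intro h3
  have : 1 ≤ padicValNat 3 m := (padicValNat_dvd_iff_le hm0).mp (by rw [pow_one]; exact h3)
  omega

/-- The same for the LITERAL row E-desc-124 on optimal curves (its `∃ m` instantiated): E-desc-157₄ ∧ E-desc-124 ∧ GIVEN ⟹ the
multiplier produced by E-124 at any optimal `Iₙ*` curve meeting the guards is prime to `3`. [folklore] -/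
theorem exists_multiplier_not_three_dvd_of_thetaTwistOmegaWitnessVal [W.IsGloballyMinimal]
    (hΘ : ThetaTwistOmegaWitnessValAtNinePrime) (hdeg : ThetaFourSqBrandtDegreeLawAtNinePrime)
    (hp : p.Prime) (h5 : 5 ≤ p) (Δ : NeronFLineDatum W D) (hN : W.conductorNorm ℤ = 9 * p) (hΩ : IsOmegaNeronAtThree Δ)
    (hopt : ∀ z ∈ D.L.lattice, ∃ w ∈ periodLattice D.f, z = D.c * w)
    (hmin : ∀ (W' : WeierstrassCurve ℚ) [W'.IsElliptic] (D' : ModularParametrizationData W' (W.conductorNorm ℤ)),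
        D'.f = D.f → D.modularDegree ≤ D'.modularDegree)
    (hj : padicValRat 3 W.j < 0)
    {g : Fin (p + 1) → ZI} (hU : IsUnitInvariant3 p g) (hprim : IsPrimitive3 p g)
    (hH : IsThetaFourSqHeckeEigen p g (fun n => W.LFunction n)) (hW : WeightedNotThreeDivisible p g)
    (hWd : WeightedDifferenceNotThreeDivisible p g) :
    ∃ m : ℕ, 1 ≤ m ∧ m ≤ 5 ∧ ¬ 3 ∣ m ∧
      3 * (m : ℤ) ^ 2 * (D.modularDegree : ℤ) = 4 * (-padicValRat 3 W.j) * thetaFourHeightSix p g := by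
  obtain ⟨m, hm1, hm5, hlaw⟩ := hdeg p hp h5 W D hN hopt hmin hj g hU hprim hH
  exact ⟨m, hm1, hm5, not_three_dvd_of_thetaTwistOmegaWitnessVal hΘ hp h5 Δ hN hΩ hj hU hH hW hWd hm1 hlaw, hlaw⟩

end Consequences

end Summit.BirchSwinnertonDyer.BirchSwinnertonDyer.Theorems.ManinPrimeToThreeAtNine.Negative
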